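import Mathlib
import Summits.ValiantsHypothesis.ValiantsHypothesis.Theses.FreeSubtorus
import Summits.ValiantsHypothesis.ValiantsHypothesis.Cruxes.OrbitDimensionBound.Lines.DegreeLadder
import Summits.ValiantsHypothesis.ValiantsHypothesis.Cruxes.OrbitDimensionBound.Lines.PowerLadder
import Literature.Computability.AlgebraicComplexity.BlockDecomposable
import Literature.Computability.AlgebraicComplexity.EquivariantDC
import Summits.ValiantsHypothesis.ValiantsHypothesis.Theorems.FreeSubtorusOrbitDimensionBoundStubDiagonalLifts
import Summits.ValiantsHypothesis.ValiantsHypothesis.Theorems.FreeSubtorusOrbitDimensionBoundStubStableReduction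

/-!
# Line `square_covering` — skeleton for the rung `Power.SquareShadow` (multiplicity dial, stable reduction)

Crux advanced: `OrbitDimensionBound` (stmt-ValiantsHypothesis-16133) of `route-ValiantsHypothesis-FreeSubtorus`; floor
`SubtorusCovering` (PROVED, `subtorusCovering_proof`); rung `Power.SquareShadow` / numeric `Power.SquareCovering =
PowerCovering 2` (`Lines/PowerLadder.lean`, sorry-free: `k = 1` IS the floor by `pow_one`, `S → PowerShadow k` PROVED for
every `k ≥ 1` via Kaltofen-free root extraction).

THE LINE (three registered stubs, composition kernel-checked; it proves the WHOLE dial `∀ k ≥ 1, PowerCovering k`).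
The floor's engine needs von zur Gathen regularity (corank of the constant part `≤ 1`), which is FALSE for
representations of `per_n ^ k` (`diag(A, A)`).  The line replaces regularity by STABILITY:
1. `stub_stableReduction` (M) — BOREL–UFD DESCENT.  If an equivariant representation `B` of `per_n ^ k` is block-decomposable
   (a proper sub-pencil `(V, W)`, `dim V = dim W`; tree notion `IsBlockDecomposable`), the variety of such sub-pencils is
   projective and the (connected, solvable) identity component of the lifted torus has a FIXED one (Borel); its two diagonal
   blocks are again equivariant (under `T_Λ° = T_{Λ^sat}`, same rank, still admissible) with determinants `c₁ per^{j₁}`,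
   `c₂ per^{j₂}`, `j₁ + j₂ = k` (UFD, `per_n` irreducible); keep a block with `j ≥ 1` and recurse on the size.  Output: a
   block-INDECOMPOSABLE equivariant affine representation of some `per_n ^ j`, `1 ≤ j ≤ k`, of size `≤ m`.
2. `stub_diagonalLifts` (M) — KING STABILITY ⇒ GRADING.  A block-indecomposable pencil with non-zero determinant is
   `θ`-stable for the Kronecker quiver (`θ = (-1, 1)`), hence Schurian (`End = ℂ`): exact lifts are UNIQUE up to scalars, so
   `γ ↦ (g_γ, h_γ)` is a projective representation of the torus, whose preimage in `GL_m × GL_m` is again a torus; after ONE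
   constant base change all lifts are DIAGONAL.  Output: an equivalent representation (same size, same power) whose lifts over
   `T_{Λ'}` (`Λ'` admissible, same rank) are pairs of diagonal matrices — every entry is a `T_{Λ'}`-semi-invariant affine form.
3. `stub_gradedPowerCount` (L, load-bearing) — GRADED COUNT FOR POWERS.  An affine matrix `B` with `det B = per_n ^ j`
   (`j ≥ 1`, `n ≥ 3`) all of whose `T_Λ`-lifts are diagonal (`Λ` admissible, `r` generators) has `C(n, ⌊n/2⌋) ≤ j · m · 2^r`.
   Here every entry is a constant (weight `0`) plus a linear form supported on ONE confusion class of variables; `det B` is a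
   signed sum over cycle covers of products of such entries, and the count runs over the weight classes met by the cycle
   covers producing the monomials `x^{u}`, `u = P_{σ₁} + ⋯ + P_{σ_j}` of `per_n ^ j`.  At `j = 1` it is implied by the floor.
Composition `powerCovering_of`: stub 1 → stub 2 → stub 3, then `j · m' · 2^r ≤ k · m · 2^r`.  Then `SquareCovering_of`
(`k = 2`), `SquareShadow_of` via the ladder's `powerShadow_of_powerCovering`, `floor_of_stubs` (`k = 1`, `Iff.rfl`) and
`summit_of_stubs : OrbitPowerBound 2 → stubs → VH` via `closes_square`.

Disproof used: `Cruxes/OrbitDimensionBound/Disproof.lean` concerns the symmetrisation crux itself (`∃ B`-targets, in-place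
refutations `orbitDimensionBound_false_without_repHyp` & co.); this line proves a lower bound for GIVEN equivariant data and
never claims a representation can be symmetrised, so it instantiates none of the refuted strengthenings.  Negatives index
(`ledger negatives --problem ValiantsHypothesis`): no refuted statement concerns powers of the permanent or stable pencils.
-/

open Matrix MvPolynomial Finset
open Literature.Computability.AlgebraicComplexity
open Summit.ValiantsHypothesis.ValiantsHypothesis.Cruxes.OrbitDimensionBound.Degree
open Summit.ValiantsHypothesis.ValiantsHypothesis.Cruxes.OrbitDimensionBound.Power

-- the mandated summit-side namespace repeats a component by design (single-problem summit)
set_option linter.dupNamespace false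

noncomputable section

namespace Summit.ValiantsHypothesis.ValiantsHypothesis.Cruxes.OrbitDimensionBound.Power.Line

/-! ## §1 Statements of the stubs -/

/-- `HasDiagonalLifts n r Λ B`: every element of the torus `T_Λ` lifts to a pair of DIAGONAL constant matrices:
`B(γ·x) = diag(u) · B(x) · diag(v)` with `u, v : Fin m → ℂˣ` (equivalently: every entry of `B` is a `T_Λ`-semi-invariant
affine form).  [cite: LandsbergRessayre2017, §3, §6] [cite: King1994, Prop. 3.1] -/
def HasDiagonalLifts (n : ℕ) {m : ℕ} (r : ℕ) (Λ : Fin r → (Fin n ⊕ Fin n) → ℤ)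
    (B : Matrix (Fin m) (Fin m) (MvPolynomial (Fin n × Fin n) ℂ)) : Prop :=
  ∀ γ ∈ Subgroup.closure (torusGen n r Λ), ∃ u v : Fin m → ℂˣ,
    Matrix.linSubstEntries γ B =
      (Matrix.diagonal fun i => C (u i : ℂ)) * B * Matrix.diagonal fun i => C (v i : ℂ)

/-- Statement of stub 1 (`stub_stableReduction`, M): Borel fixed point on the projective variety of equal-dimension
sub-pencils + UFD descent (`per_n` irreducible) ⇒ a block-indecomposable equivariant affine representation of some power
`per_n ^ j`, `1 ≤ j ≤ k`, of size `≤ m`, equivariant under an admissible `Λ'` of the same rank (a basis of the saturation,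
cutting out the identity component `T_Λ°`). [cite: LandsbergRessayre2017, §3, §6] [cite: King1994, §3] -/
def Stmt.stub_stableReduction : Prop :=
  ∀ (n k m r : ℕ) (Λ : Fin r → (Fin n ⊕ Fin n) → ℤ) (B : Matrix (Fin m) (Fin m) (MvPolynomial (Fin n × Fin n) ℂ)),
    3 ≤ n → 1 ≤ k → Admissible n r Λ →
    IsEquivariantDetRepr (Subgroup.closure (torusGen n r Λ)) (perPoly (Fin n) ℂ ^ k) B →
    ∃ (j m' : ℕ) (Λ' : Fin r → (Fin n ⊕ Fin n) → ℤ) (B' : Matrix (Fin m') (Fin m') (MvPolynomial (Fin n × Fin n) ℂ)),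
      1 ≤ j ∧ j ≤ k ∧ m' ≤ m ∧ Admissible n r Λ' ∧
      IsEquivariantDetRepr (Subgroup.closure (torusGen n r Λ')) (perPoly (Fin n) ℂ ^ j) B' ∧
      ¬ IsBlockDecomposable B'

/-- Statement of stub 2 (`stub_diagonalLifts`, M): a block-indecomposable pencil with non-zero determinant is King-stable,
hence Schurian; lifts are unique up to scalars, form a torus, and diagonalise simultaneously after one constant base change
(again over an admissible `Λ'` of the same rank). [cite: King1994, Prop. 3.1, Thm. 4.1] [cite: LandsbergRessayre2017, §3] -/
def Stmt.stub_diagonalLifts : Prop :=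
  ∀ (n j m r : ℕ) (Λ : Fin r → (Fin n ⊕ Fin n) → ℤ) (B : Matrix (Fin m) (Fin m) (MvPolynomial (Fin n × Fin n) ℂ)),
    3 ≤ n → 1 ≤ j → Admissible n r Λ →
    IsEquivariantDetRepr (Subgroup.closure (torusGen n r Λ)) (perPoly (Fin n) ℂ ^ j) B →
    ¬ IsBlockDecomposable B →
    ∃ (Λ' : Fin r → (Fin n ⊕ Fin n) → ℤ) (B' : Matrix (Fin m) (Fin m) (MvPolynomial (Fin n × Fin n) ℂ)),
      Admissible n r Λ' ∧ IsAffineDetRepr (perPoly (Fin n) ℂ ^ j) B' ∧ HasDiagonalLifts n r Λ' B'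

/-- Statement of stub 3 (`stub_gradedPowerCount`, L — load-bearing): the covering count for DIAGONALLY graded affine
representations of a power of the permanent, with loss the exponent `j`.  At `j = 1` implied by the floor.
[cite: LandsbergRessayre2017, Thm. 2.8, §6] [cite: Eisenbud1980, Thm. 6.1] -/
def Stmt.stub_gradedPowerCount : Prop :=
  ∀ (n j m r : ℕ) (Λ : Fin r → (Fin n ⊕ Fin n) → ℤ) (B : Matrix (Fin m) (Fin m) (MvPolynomial (Fin n × Fin n) ℂ)),
    3 ≤ n → 1 ≤ j → Admissible n r Λ →
    IsAffineDetRepr (perPoly (Fin n) ℂ ^ j) B → HasDiagonalLifts n r Λ B →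
    Nat.choose n (n / 2) ≤ j * (m * 2 ^ r)

/-! ## §2 The registered stubs -/

/-- Stub 1: stable (block-indecomposable) reduction — CLOSED BY NAME by the landed helper
`Theorems/FreeSubtorusOrbitDimensionBoundStubStableReduction.lean` (val-width-16133-w1 g3; Borel-free: saturation of `Λ`
(val-lit-p4 g12), socle dichotomy in King's category of `θ`-semistable pencils, two-block split / block-diagonal form,
twisted Schur and the permutation of block types, UFD descent), whose statement is `Stmt.stub_stableReduction` with
`torusGen` / `Admissible` unfolded. [cite: LandsbergRessayre2017, §3, §6] [cite: King1994, §3] -/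
theorem stub_stableReduction : Stmt.stub_stableReduction :=
  Summit.ValiantsHypothesis.ValiantsHypothesis.Theorems.FreeSubtorusOrbitDimensionBound.SquareCovering.StableReduction.stub_stableReduction

/-- Stub 2: King stability ⇒ Schurian ⇒ unique lifts ⇒ diagonal lifts — CLOSED BY NAME by the landed helper
`Theorems/FreeSubtorusOrbitDimensionBoundStubDiagonalLifts.lean` (p613768, val-lit-p4 g12: stable ⇒ Schurian ⇒ lifts unique up to
scalars ⇒ semisimple, commuting over the saturated `Λ'` ⇒ one joint eigenbasis), whose statement is `Stmt.stub_diagonalLifts` with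
`torusGen` / `Admissible` / `HasDiagonalLifts` unfolded. [cite: King1994, Prop. 3.1, Thm. 4.1] -/
theorem stub_diagonalLifts : Stmt.stub_diagonalLifts :=
  Summit.ValiantsHypothesis.ValiantsHypothesis.Theorems.FreeSubtorusOrbitDimensionBound.SquareCovering.stub_diagonalLifts

/-- Stub 3: graded covering count for powers (load-bearing). [cite: LandsbergRessayre2017, Thm. 2.8, §6] -/
theorem stub_gradedPowerCount : Stmt.stub_gradedPowerCount := by
  sorry

/-! ## §3 Composition (kernel-checked, no sorry below this line) -/

/-- **The whole dial from the three stubs**: `∀ k ≥ 1, PowerCovering k` — stable reduction → diagonal lifts → graded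
count, then `j · m' · 2^r ≤ k · m · 2^r`. [cite: LandsbergRessayre2017, Thm. 2.8, §6] [cite: King1994, Thm. 4.1] -/
theorem powerCovering_of (h₁ : Stmt.stub_stableReduction) (h₂ : Stmt.stub_diagonalLifts)
    (h₃ : Stmt.stub_gradedPowerCount) (k : ℕ) (hk : 1 ≤ k) : PowerCovering k := by
  intro n hn m r Λ B hΛ hB
  obtain ⟨j, m', Λ', B', hj1, hjk, hm', hΛ', hB', hind⟩ := h₁ n k m r Λ B hn hk hΛ hB
  obtain ⟨Λ'', B'', hΛ'', haff, hdiag⟩ := h₂ n j m' r Λ' B' hn hj1 hΛ' hB' hind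
  calc n.choose (n / 2) ≤ j * (m' * 2 ^ r) := h₃ n j m' r Λ'' B'' hn hj1 hΛ'' haff hdiag
    _ ≤ k * (m * 2 ^ r) := by gcongr

/-- **The rung, numeric form (`k = 2`), from the three stubs.** [cite: LandsbergRessayre2017, Question 2.2] -/
theorem SquareCovering_of (h₁ : Stmt.stub_stableReduction) (h₂ : Stmt.stub_diagonalLifts)
    (h₃ : Stmt.stub_gradedPowerCount) : SquareCovering :=
  powerCovering_of h₁ h₂ h₃ 2 (by norm_num)

/-- **The rung (filed declaration `SquareShadow`) from the three stubs.** [cite: LandsbergRessayre2017, Question 2.2] -/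
theorem SquareShadow_of (h₁ : Stmt.stub_stableReduction) (h₂ : Stmt.stub_diagonalLifts)
    (h₃ : Stmt.stub_gradedPowerCount) : SquareShadow :=
  powerShadow_of_powerCovering (SquareCovering_of h₁ h₂ h₃)

/-- Every notch `k ≥ 1` of the shadow dial from the stubs. [cite: LandsbergRessayre2017, Question 2.2] -/
theorem PowerShadow_of (h₁ : Stmt.stub_stableReduction) (h₂ : Stmt.stub_diagonalLifts)
    (h₃ : Stmt.stub_gradedPowerCount) (k : ℕ) (hk : 1 ≤ k) : PowerShadow k :=
  powerShadow_of_powerCovering (powerCovering_of h₁ h₂ h₃ k hk)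

/-- The rung, assembled from the registered stubs (sorries live only inside `stub_*`). [cite: LandsbergRessayre2017, Question 2.2] -/
theorem SquareShadow_proof : SquareShadow :=
  SquareShadow_of stub_stableReduction stub_diagonalLifts stub_gradedPowerCount

/-- The line re-proves the floor (dial at `k = 1` ⇒ floor, `pow_one`). [cite: LandsbergRessayre2017, Thm. 2.8] -/
theorem floor_of_stubs (h₁ : Stmt.stub_stableReduction) (h₂ : Stmt.stub_diagonalLifts)
    (h₃ : Stmt.stub_gradedPowerCount) :
    Summit.ValiantsHypothesis.ValiantsHypothesis.Theses.FreeSubtorus.SubtorusCovering :=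
  powerCovering_one_iff.mp (powerCovering_of h₁ h₂ h₃ 1 le_rfl)

/-- … and the RELAXED closing of the host route: symmetrisation into a power `≤ 2` + the rung ⇒ the summit.
[cite: LandsbergRessayre2017, Question 2.2] -/
theorem summit_of_stubs (h₀ : OrbitPowerBound 2) (h₁ : Stmt.stub_stableReduction) (h₂ : Stmt.stub_diagonalLifts)
    (h₃ : Stmt.stub_gradedPowerCount) : _root_.ValiantsHypothesis :=
  closes_square h₀ (SquareCovering_of h₁ h₂ h₃)

end Summit.ValiantsHypothesis.ValiantsHypothesis.Cruxes.OrbitDimensionBound.Power.Line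

end
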